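import Summits.Ventures.Crystal3D.Theorems.StickyWulffConstantGenericWallFloorStackWalkFrames
import HarnessLib

/-!
# The end of a stack walk stays off the far clamped sample — frame-set form
# (crux `GenericWallFloor`, line `WallLedgerG`; forced-chain localisation of the stack ledger, brick 3)

HONEST FRAMING. Part of the venture `Summits/Ventures/Crystal3D` (cell `crystal3d-full`), helper `--supports` the
crux `GenericWallFloor` (stmt-Ventures-19480) of `route-Ventures-StickyWulffConstant`, registered line `WallLedgerG`,
open stub `stub_twoSlabAdhesion` (general fillings).  `stackWalk_end_not_high` / `stackWalk_end_not_low`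
(`…StackWalkFrames`) keep the walker's frames in a mirror-closed family avoiding the far lattice; the family is used
only at the END state: the top frame there must not have the far sample's linear lattice (a high end ball has three
independent exact neighbours in the far sample, `movedFcc_eq_of_exact_neighbours_high`).  Here the hypothesis is
stated in exactly that form — every frame ON THE END STACK has a lattice different from the far one — so that the
forced-ray structure theorem (`…StackWalkForcedChain`) can supply it for chain pairs too.

* `stackWalk_end_not_high_sep`, `stackWalk_end_not_low_sep`.

WHAT THIS IS NOT: not the stub; F-C1 not moved.
-/

noncomputable section

namespace Summit.Ventures.Crystal3D.Theorems

open Summit.Ventures.Crystal3D Finset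
open Literature.MathematicalPhysics.StatisticalMechanics (fccStacking)
open scoped InnerProductSpace

variable {X : Finset (EuclideanSpace ℝ (Fin 3))}

/-- **The end of a stack walk whose end frames avoid `A₂·Λ₀` is not high.**  If every frame on the END stack has a
linear lattice different from `A₂·Λ₀`, the start satisfies `WalkInv`, the fuel suffices, and the end ball is off the
rim (lateral radius `≤ ρ − 2`), then the end ball lies strictly below height `h + R₀ + 2`. -/
theorem stackWalk_end_not_high_sep (hX : ∀ p ∈ X, ∀ q ∈ X, p ≠ q → 1 ≤ dist p q)
    {s₀ : EuclideanSpace ℝ (Fin 3)} (hs₀ : s₀ ∈ fccSlots)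
    (hcert : ExactOnly 0 (fccSlots.filter fun w => 0 < ⟪w, s₀⟫_ℝ))
    (A₂ : EuclideanSpace ℝ (Fin 3) ≃ₗᵢ[ℝ] EuclideanSpace ℝ (Fin 3)) (t₂ : EuclideanSpace ℝ (Fin 3))
    (P₂ : Finset (EuclideanSpace ℝ (Fin 3))) (R₀ h ρ : ℝ) (hρ2 : 2 ≤ ρ) (hP₂X : P₂ ⊆ X)
    (hcell : ∀ p ∈ X, p 2 ≤ h + 2 * R₀)
    (hP₂ : ∀ p, p ∈ P₂ ↔ (p ∈ (fun q => A₂ q + t₂) '' fccStacking 1 (Real.sqrt (2 / 3)) ∧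
      h + R₀ ≤ p 2 ∧ p 2 ≤ h + 2 * R₀ ∧ p 0 ^ 2 + p 1 ^ 2 ≤ ρ ^ 2))
    {z : EuclideanSpace ℝ (Fin 3)} (hz : ‖z‖ = 1) {H : ℝ} (hH : ∀ p ∈ X, ⟪p, z⟫_ℝ ≤ H)
    {s : EuclideanSpace ℝ (Fin 3) × List WalkEntry} (hInv : WalkInv X z s)
    {N : ℕ} (hN : 8 * (H - ⟪s.1, z⟫_ℝ) < 3 * N)
    (hfr : ∀ e ∈ (walkRun X z N s).2,
      e.frame '' fccStacking 1 (Real.sqrt (2 / 3)) ≠ A₂ '' fccStacking 1 (Real.sqrt (2 / 3)))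
    (hyr : (walkRun X z N s).1 0 ^ 2 + (walkRun X z N s).1 1 ^ 2 ≤ (ρ - 2) ^ 2) :
    (walkRun X z N s).1 2 < h + R₀ + 2 := by
  by_contra hge
  push Not at hge
  obtain ⟨hyX, -, -, -, hI, -⟩ := stackWalk_end hX hs₀ hcert hz hH hInv hN
  obtain ⟨-, hS, e, rest, hstk, hC⟩ := hI
  have he : e.frame '' fccStacking 1 (Real.sqrt (2 / 3)) ≠ A₂ '' fccStacking 1 (Real.sqrt (2 / 3)) :=
    hfr e (by rw [hstk]; simp)
  rw [hstk] at hS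
  obtain ⟨a, ha, b, hb, c, hc, hind, haX, hbX, hcX⟩ := walkCertified_three_independent hS.top.1 hC
  exact he (movedFcc_eq_of_exact_neighbours_high A₂ t₂ X P₂ R₀ h ρ hρ2 hX hP₂X hcell hP₂
    e.frame hyX hge hyr ha hb hc hind haX hbX hcX)

/-- **The end of a stack walk whose end frames avoid `A₁·Λ₀` is not low** (the mirror statement for the walkers
of the top grain). -/
theorem stackWalk_end_not_low_sep (hX : ∀ p ∈ X, ∀ q ∈ X, p ≠ q → 1 ≤ dist p q)
    {s₀ : EuclideanSpace ℝ (Fin 3)} (hs₀ : s₀ ∈ fccSlots)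
    (hcert : ExactOnly 0 (fccSlots.filter fun w => 0 < ⟪w, s₀⟫_ℝ))
    (A₁ : EuclideanSpace ℝ (Fin 3) ≃ₗᵢ[ℝ] EuclideanSpace ℝ (Fin 3)) (t₁ : EuclideanSpace ℝ (Fin 3))
    (P₁ : Finset (EuclideanSpace ℝ (Fin 3))) (R₀ ρ : ℝ) (hρ2 : 2 ≤ ρ) (hP₁X : P₁ ⊆ X)
    (hcell : ∀ p ∈ X, -(2 * R₀) ≤ p 2)
    (hP₁ : ∀ p, p ∈ P₁ ↔ (p ∈ (fun q => A₁ q + t₁) '' fccStacking 1 (Real.sqrt (2 / 3)) ∧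
      -(2 * R₀) ≤ p 2 ∧ p 2 ≤ -R₀ ∧ p 0 ^ 2 + p 1 ^ 2 ≤ ρ ^ 2))
    {z : EuclideanSpace ℝ (Fin 3)} (hz : ‖z‖ = 1) {H : ℝ} (hH : ∀ p ∈ X, ⟪p, z⟫_ℝ ≤ H)
    {s : EuclideanSpace ℝ (Fin 3) × List WalkEntry} (hInv : WalkInv X z s)
    {N : ℕ} (hN : 8 * (H - ⟪s.1, z⟫_ℝ) < 3 * N)
    (hfr : ∀ e ∈ (walkRun X z N s).2,
      e.frame '' fccStacking 1 (Real.sqrt (2 / 3)) ≠ A₁ '' fccStacking 1 (Real.sqrt (2 / 3)))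
    (hyr : (walkRun X z N s).1 0 ^ 2 + (walkRun X z N s).1 1 ^ 2 ≤ (ρ - 2) ^ 2) :
    -R₀ - 2 < (walkRun X z N s).1 2 := by
  by_contra hle
  push Not at hle
  obtain ⟨hyX, -, -, -, hI, -⟩ := stackWalk_end hX hs₀ hcert hz hH hInv hN
  obtain ⟨-, hS, e, rest, hstk, hC⟩ := hI
  have he : e.frame '' fccStacking 1 (Real.sqrt (2 / 3)) ≠ A₁ '' fccStacking 1 (Real.sqrt (2 / 3)) :=
    hfr e (by rw [hstk]; simp)
  rw [hstk] at hS
  obtain ⟨a, ha, b, hb, c, hc, hind, haX, hbX, hcX⟩ := walkCertified_three_independent hS.top.1 hC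
  exact he (movedFcc_eq_of_exact_neighbours_low A₁ t₁ X P₁ R₀ ρ hρ2 hX hP₁X hcell hP₁
    e.frame hyX hle hyr ha hb hc hind haX hbX hcX)

end Summit.Ventures.Crystal3D.Theorems

end
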